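import Literature.NumberTheory.Weil1964.ArchWeilDatum
import Literature.Analysis.SegalBargmann.SchwartzMetaplecticGenerators
import HarnessLib

/-!
# Exact values of an archimedean Weil datum on Levi-rescaled unipotent one-parameter subgroups

Source of the objects: G. B. Folland, *Harmonic Analysis in Phase Space* (1989), Ch. 4 §2 (4.24)–(4.25) (the
tree's explicit implementers `leviS a`, `chirpS b` of the Siegel parabolic, file `SchwartzMetaplecticGenerators`)
and the tree's hypothesis structure `IsArchWeilDatum ι𝕎 ω` (file `ArchWeilDatum`: an oscillator representation
`ω` of an abstract topological group `G_∞` over `ι𝕎 : G_∞ →* Sp(ℝ^σ × ℝ^σ)`).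

Everything here is PROVED; no statement of print is asserted or used as a hypothesis.

## Main results

For a datum `hW : IsArchWeilDatum ι𝕎 ω`:

* §1 `exists_unit_smul_chirpS` / `exists_unit_smul_leviS`: an element of `G_∞` acting on phase space as a
  Siegel chirp `(p,q) ↦ (p, q + bp)` (resp. a Levi element `(p,q) ↦ (ap, dq)`) is represented by a unimodular
  multiple of `chirpS b` (resp. `leviS a`) — the tree's rigidity `implements_eq_unitSmul_of_liftsTo`.
* §2 **`apply_eq_chirpS` (zero-point pin, unipotent part)**: if `u : ℝ → G_∞` is a one-parameter family
  (`u (y + y') = u y * u y'`) acting as the chirps `(p,q) ↦ (p, q + y • bp)`, and some `d ∈ G_∞` acting as a Levi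
  element `(ap, d′q)` rescales it, `d * u y * d⁻¹ = u (n * y)` with `d′ ∘ b ∘ a⁻¹ = n • b` for a natural number
  `n ≥ 2`, then `ω (u y) = chirpS (y • b)` EXACTLY (no scalar ambiguity).  The proof is algebraic: the relative
  phase `α : ℝ → S¹` is additive, `α (n y) = α y ^ n`, and Levi conjugation (`leviS_chirpS_smul`) gives
  `α (n y) = α y`; hence `α y ^ (n-1) = 1` for all `y`, and `α y = α (y/(n-1)) ^ (n-1) = 1`.  No continuity of
  `α` is used.

## References

* [Folland1989] G. B. Folland, *Harmonic Analysis in Phase Space*, Annals of Mathematics Studies 122, Princeton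
  UP, 1989, Ch. 4 §2 (4.23)–(4.25) (doi:10.1515/9781400882427).
* [MoeglinVignerasWaldspurger1987] C. Moeglin, M.-F. Vignéras, J.-L. Waldspurger, *Correspondances de Howe sur un
  corps p-adique*, LNM 1291, Springer, 1987, Chap. 2, II.1–II.2 (doi:10.1007/BFb0082712).
-/

set_option autoImplicit false

noncomputable section

open MeasureTheory Complex SchwartzMap

namespace Literature.NumberTheory.Weil1964

open Literature.Analysis.SegalBargmann Literature.RepresentationTheory.HeisenbergGroup

variable {σ : Type*} [Fintype σ] [DecidableEq σ]
variable {Ginf : Type*} [Group Ginf] [TopologicalSpace Ginf]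

local notation "L2R" σ => Lp ℂ 2 (volume : Measure (σ → ℝ))
local notation "SR" σ => SchwartzMap (σ → ℝ) ℂ
local notation "PV" σ => (σ → ℝ) × (σ → ℝ)
local notation "SpR" σ => symplecticGroup (polar (dotPairing σ))

namespace IsArchWeilDatum

variable {ι𝕎 : Ginf →* SpR σ} {ω : Representation ℂ Ginf (SR σ)}

/-! ## 1. Elements acting as Siegel chirps / Levi elements are represented by unit multiples of `chirpS` / `leviS` -/

/-- If `g ∈ G_∞` acts on phase space as the Siegel chirp `(p,q) ↦ (p, q + bp)` (`b` symmetric), then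
`ω g = c • chirpS b` with `‖c‖ = 1`. [cite: Folland1989, §4.2 (4.25) with the Schur remark after (4.23)] -/
theorem exists_unit_smul_chirpS (hW : IsArchWeilDatum ι𝕎 ω) {g : Ginf} {b : (σ → ℝ) →ₗ[ℝ] (σ → ℝ)}
    (hb : ∀ x x' : σ → ℝ, x ⬝ᵥ b x' = x' ⬝ᵥ b x)
    (hg : ∀ p q : σ → ℝ, (ι𝕎 g).1 (p, q) = (p, q + b p)) :
    ∃ c : ℂ, ‖c‖ = 1 ∧ ∀ f : SR σ, ω g f = c • chirpS b f := by
  have hM : Implements (schwartzSchrodinger σ) (ofSymplectic _ (ι𝕎 g))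
      (chirpEquiv b : (SR σ) ≃ₗ[ℂ] SR σ) := by
    rw [implements_ofSymplectic_iff]
    intro p q f
    rw [hg p q]
    exact chirpS_rhoS hb p q f
  obtain ⟨U, hU⟩ := hW.exists_lift g
  have hU' : LiftsTo ((repGL ω g : (SR σ) ≃ₗ[ℂ] SR σ) : (SR σ) →ₗ[ℂ] SR σ)
      ((U.toContinuousLinearEquiv : (L2R σ) ≃L[ℂ] L2R σ) : (L2R σ) →L[ℂ] L2R σ) := by
    rw [coe_repGL]
    exact hU
  obtain ⟨c, hc, h⟩ := implements_eq_unitSmul_of_liftsTo (hM := hM) (hM' := hW.implements g)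
    (hU := liftsTo_chirpS b) (hU' := hU')
  exact ⟨c, hc, fun f => h f⟩

/-- If `d ∈ G_∞` acts on phase space as the Levi element `(p,q) ↦ (ap, d′q)` (`a x · d′ y = x · y`), then
`ω d = c • leviS a` with `‖c‖ = 1`. [cite: Folland1989, §4.2 (4.24) with the Schur remark after (4.23)] -/
theorem exists_unit_smul_leviS (hW : IsArchWeilDatum ι𝕎 ω) {g : Ginf} {a d : (σ → ℝ) ≃ₗ[ℝ] (σ → ℝ)}
    (had : ∀ x y : σ → ℝ, a x ⬝ᵥ d y = x ⬝ᵥ y)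
    (hg : ∀ p q : σ → ℝ, (ι𝕎 g).1 (p, q) = (a p, d q)) :
    ∃ c : ℂ, ‖c‖ = 1 ∧ ∀ f : SR σ, ω g f = c • leviS a f := by
  have hM : Implements (schwartzSchrodinger σ) (ofSymplectic _ (ι𝕎 g))
      (leviEquiv a : (SR σ) ≃ₗ[ℂ] SR σ) := by
    rw [implements_ofSymplectic_iff]
    intro p q f
    rw [hg p q]
    exact leviS_rhoS had p q f
  obtain ⟨U, hU⟩ := hW.exists_lift g
  have hU' : LiftsTo ((repGL ω g : (SR σ) ≃ₗ[ℂ] SR σ) : (SR σ) →ₗ[ℂ] SR σ)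
      ((U.toContinuousLinearEquiv : (L2R σ) ≃L[ℂ] L2R σ) : (L2R σ) →L[ℂ] L2R σ) := by
    rw [coe_repGL]
    exact hU
  obtain ⟨c, hc, h⟩ := implements_eq_unitSmul_of_liftsTo (hM := hM) (hM' := hW.implements g)
    (hU := liftsTo_leviS (a := a)) (hU' := hU')
  exact ⟨c, hc, fun f => h f⟩

/-! ## 2. The zero-point pin on a Levi-rescaled unipotent one-parameter family -/

omit [DecidableEq σ] in
/-- Symmetry of `b` passes to `y • b`. [folklore] -/
theorem dotProduct_smul_symm {b : (σ → ℝ) →ₗ[ℝ] (σ → ℝ)} (hb : ∀ x x' : σ → ℝ, x ⬝ᵥ b x' = x' ⬝ᵥ b x)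
    (y : ℝ) (x x' : σ → ℝ) : x ⬝ᵥ (y • b) x' = x' ⬝ᵥ (y • b) x := by
  rw [LinearMap.smul_apply, LinearMap.smul_apply, dotProduct_smul, dotProduct_smul, hb]

/-- **Zero-point pin, unipotent part.**  Let `u : ℝ → G_∞` be a one-parameter family acting on phase space as
the Siegel chirps `(p,q) ↦ (p, q + y • bp)`, rescaled by a Levi-type element `d ∈ G_∞`:
`d * u y * d⁻¹ = u (n * y)` where `d` acts as `(ap, d′q)` with `d′ ∘ b ∘ a⁻¹ = n • b`, `n ≥ 2` a natural number.
Then the datum takes the EXACT values `ω (u y) = chirpS (y • b)`.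
[cite: Folland1989, §4.2 (4.24)–(4.25) with the Schur remark after (4.23)] -/
theorem apply_eq_chirpS (hW : IsArchWeilDatum ι𝕎 ω) {b : (σ → ℝ) →ₗ[ℝ] (σ → ℝ)}
    (hb : ∀ x x' : σ → ℝ, x ⬝ᵥ b x' = x' ⬝ᵥ b x)
    {u : ℝ → Ginf} (hu : ∀ y y' : ℝ, u (y + y') = u y * u y')
    (hιu : ∀ (y : ℝ) (p q : σ → ℝ), (ι𝕎 (u y)).1 (p, q) = (p, q + (y • b) p))
    {d : Ginf} {a d' : (σ → ℝ) ≃ₗ[ℝ] (σ → ℝ)} (had : ∀ x y : σ → ℝ, a x ⬝ᵥ d' y = x ⬝ᵥ y)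
    (hιd : ∀ p q : σ → ℝ, (ι𝕎 d).1 (p, q) = (a p, d' q))
    {n : ℕ} (hn : 2 ≤ n)
    (hc : (d' : (σ → ℝ) →ₗ[ℝ] (σ → ℝ)) ∘ₗ b ∘ₗ (a.symm : (σ → ℝ) →ₗ[ℝ] (σ → ℝ)) = (n : ℝ) • b)
    (hconj : ∀ y : ℝ, d * u y * d⁻¹ = u (n * y)) (y : ℝ) (f : SR σ) :
    ω (u y) f = chirpS (y • b) f := by
  classical
  -- degenerate carrier: nothing to prove
  rcases forall_or_exists_not (fun g : SR σ => g = 0) with htriv | ⟨f₀, hf₀⟩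
  · rw [htriv (ω (u y) f), htriv (chirpS (y • b) f)]
  -- the relative phase `α`
  have hex : ∀ y : ℝ, ∃ c : ℂ, ‖c‖ = 1 ∧ ∀ f : SR σ, ω (u y) f = c • chirpS (y • b) f :=
    fun y => hW.exists_unit_smul_chirpS (dotProduct_smul_symm hb y) (hιu y)
  choose α hαn hα using hex
  have hα0 : ∀ y, α y ≠ 0 := fun y h => by simpa [h] using hαn y
  -- cancellation: `chirpS` never kills `f₀`
  have hcf₀ : ∀ y : ℝ, chirpS (y • b) f₀ ≠ 0 := by
    intro y h
    apply hf₀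
    have h1 := congrArg (chirpS (-(y • b))) h
    rwa [map_zero, ← ContinuousLinearMap.comp_apply, chirpS_neg_comp, ContinuousLinearMap.id_apply] at h1
  -- additivity of `α`
  have hadd : ∀ y y' : ℝ, α (y + y') = α y * α y' := by
    intro y y'
    have h1 : ω (u (y + y')) f₀ = (α y * α y') • chirpS ((y + y') • b) f₀ := by
      rw [hu, map_mul, Module.End.mul_apply, hα y', map_smul, hα y, smul_smul, add_smul, chirpS_add,
        ContinuousLinearMap.comp_apply, mul_comm]
    rw [hα (y + y')] at h1
    exact smul_left_injective ℂ (hcf₀ (y + y')) h1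
  have hzero : α 0 = 1 := by
    have h1 := hadd 0 0
    rw [add_zero] at h1
    exact (mul_eq_left₀ (hα0 0)).1 h1.symm
  have hpow : ∀ (k : ℕ) (y : ℝ), α ((k : ℝ) * y) = α y ^ k := by
    intro k y
    induction k with
    | zero => rw [Nat.cast_zero, zero_mul, hzero, pow_zero]
    | succ k ih => rw [Nat.cast_succ, add_mul, one_mul, hadd, ih, pow_succ]
  -- Levi conjugation: `α (n y) = α y`
  obtain ⟨β, hβn, hβ⟩ := hW.exists_unit_smul_leviS had hιd
  have hβ0 : β ≠ 0 := fun h => by simp [h] at hβn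
  have hlf₀ : ∀ y : ℝ, chirpS (y • b) (leviS a f₀) ≠ 0 := by
    intro y h
    apply hf₀
    have h1 := congrArg (chirpS (-(y • b))) h
    rw [map_zero, ← ContinuousLinearMap.comp_apply, chirpS_neg_comp, ContinuousLinearMap.id_apply] at h1
    have h2 := congrArg (leviS a⁻¹) h1
    rwa [map_zero, ← ContinuousLinearMap.comp_apply, ← leviS_mul, inv_mul_cancel, leviS_one,
      ContinuousLinearMap.id_apply] at h2
  have hscale : ∀ y : ℝ, α ((n : ℝ) * y) = α y := by
    intro y
    have hinv : ω d⁻¹ (ω d f₀) = f₀ := by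
      rw [← Module.End.mul_apply, ← map_mul, inv_mul_cancel, map_one, Module.End.one_apply]
    -- `ω d (ω (u y) f₀) = ω (u (n y)) (ω d f₀)`
    have h1 : ω d (ω (u y) f₀) = ω (u ((n : ℝ) * y)) (ω d f₀) := by
      rw [← hconj y, map_mul, map_mul, Module.End.mul_apply, Module.End.mul_apply, hinv]
    have hlc : leviS a (chirpS (y • b) f₀) = chirpS (((n : ℝ) * y) • b) (leviS a f₀) := by
      show ((leviS a).comp (chirpS (y • b))) f₀ = ((chirpS (((n : ℝ) * y) • b)).comp (leviS a)) f₀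
      rw [leviS_chirpS_smul had hc y]
    rw [hα y, map_smul, hβ (chirpS (y • b) f₀), hlc, hβ f₀, map_smul, hα ((n : ℝ) * y) (leviS a f₀),
      smul_smul, smul_smul] at h1
    have h2 : α y * β = β * α ((n : ℝ) * y) := smul_left_injective ℂ (hlf₀ ((n : ℝ) * y)) h1
    rw [mul_comm] at h2
    exact (mul_right_injective₀ hβ0 h2).symm
  -- conclusion: `α y ^ (n - 1) = 1`, hence `α ≡ 1`
  have hroot : ∀ y : ℝ, α y ^ (n - 1) = 1 := by
    intro y
    have h1 : α y ^ n = α y := by rw [← hpow, hscale]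
    have h2 : α y ^ (n - 1) * α y = 1 * α y := by
      rw [← pow_succ, Nat.sub_add_cancel (by omega), h1, one_mul]
    exact mul_right_cancel₀ (hα0 y) h2
  have hone : α y = 1 := by
    have hn1 : ((n - 1 : ℕ) : ℝ) ≠ 0 := by
      rw [Nat.cast_ne_zero]; omega
    have h1 : α y = α (y / ((n - 1 : ℕ) : ℝ)) ^ (n - 1) := by
      rw [← hpow, mul_div_cancel₀ _ hn1]
    rw [h1, hroot]
  rw [hα y, hone, one_smul]

end IsArchWeilDatum

end Literature.NumberTheory.Weil1964
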